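import Mathlib.Analysis.SpecialFunctions.Complex.LogBounds
import Mathlib.Analysis.Complex.Polynomial.Basic
import Mathlib.FieldTheory.IsAlgClosed.Basic
import Mathlib.Algebra.BigOperators.NatAntidiagonal
import HarnessLib

/-!
# Barvinok's interpolation lemma: Taylor truncation of `log p` for a zero-free polynomial

Topic `Literature/Analysis/Complex` (namespace `Literature.Analysis.Complex`). Everything in this
file is PROVED (no named facts).

This is the analytic core of Barvinok's "polynomial interpolation" method for approximating
partition functions (Barvinok 2016, §2.2; Patel–Regts 2017, §2): if a complex polynomial
`p(z) = a₀ + a₁ z + ⋯ + a_N z^N` has no zeros in the disc `‖z‖ < β` with `β > 1`, then the branch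
`f(z) = ln p(z)` with `f(0) = Log a₀`,

  `f(z) = Log p(0) + ∑_{α root of p} Log (1 - z/α)`     (`rootLog p z`; Barvinok's (2.2.1)),

is approximated on the closed unit disc by its order-`m` Taylor polynomial at `0`,

  `T_m(z) = Log p(0) - ∑_{k=1}^{m} (p_k / k) z^k`,  `p_k = ∑_α α^{-k}`   (`logTaylorTrunc p m z`),

within `N / ((m+1) β^m (β-1))` (**Lemma 2.2.1**, `norm_rootLog_sub_logTaylorTrunc_le`), and the
numbers `p_1, …, p_m` (the inverse power sums of the roots, `invPowerSum`) are determined by the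
coefficients `a₀, …, a_m` through the triangular Newton identities
`k a_k = -∑_{i<k} a_i p_{k-i}` (**§2.2.2** in the coefficient form of Patel–Regts Prop. 2.1,
`natCast_mul_coeff_eq_neg_sum`; determination `invPowerSum_eq_of_coeff_eq`,
`logTaylorTrunc_eq_of_coeff_eq`). Consequently two such polynomials with the same first `m + 1`
coefficients have logarithms within `(deg p + deg q)/((m+1) β^m (β-1))` of each other on the unit
disc (`norm_rootLog_sub_rootLog_le`, `abs_log_norm_eval_sub_log_norm_eval_le`).

Main declarations
* `invPowerSum p k = ∑_α α⁻¹ ^ k` over the roots of `p` (with multiplicity);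
* `rootLog p z`, Barvinok's branch of `log p` on the zero-free disc: `exp (rootLog p z) = p z`
  (`exp_rootLog`), `re (rootLog p z) = Real.log ‖p z‖` (`re_rootLog`), and its power series at `0`
  is `Log p(0) - ∑_{k ≥ 1} (p_k/k) z^k` on the disc `‖z‖ < min_α ‖α‖` (`hasSum_rootLog`), so that
  `logTaylorTrunc p m` IS its Taylor polynomial of order `m` (`tendsto_logTaylorTrunc`);
* `norm_rootLog_sub_logTaylorTrunc_le` — Lemma 2.2.1 as restated by Barvinok (2024, Lemma 5.2:
  hypothesis on the OPEN disc `‖z‖ < β`, conclusion for all `‖z‖ ≤ 1`); the book / DA-paper form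
  (closed disc, `z = 1`) is the special case `norm_rootLog_one_sub_logTaylorTrunc_one_le`;
* `natCast_mul_coeff_eq_neg_sum` — the Newton identities `k a_k = -∑_{i<k} a_i p_{k-i}`
  (Patel–Regts 2017, Prop. 2.1; equivalent to Barvinok's triangular system (2.2.2)/(7.2.1)
  `g^{(k)}(0) = ∑_{j<k} C(k-1,j) g^{(j)}(0) f^{(k-j)}(0)`), proved here for `∏_γ (1 - γ X)` over any
  commutative ring by induction on the multiset of inverse roots (`newton_prod_one_sub_C_mul_X`).

Proof of Lemma 2.2.1 (Barvinok 2016 §2.2 = Barvinok DA 2017 Lemma 7.1, followed literally): over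
`ℂ` the polynomial splits, `p(z) = p(0) ∏_α (1 - z/α)` (`eval_eq_eval_zero_mul_prod`); each root has
`‖α‖ ≥ β` so `‖z/α‖ ≤ 1/β < 1` for `‖z‖ ≤ 1`; Mathlib's `Complex.norm_log_sub_logTaylor_le` bounds the
tail `|Log(1 - w) + ∑_{k ≤ m} w^k/k| ≤ |w|^{m+1}/((m+1)(1-|w|)) ≤ 1/((m+1) β^m (β-1))`; sum over the
`≤ N` roots.

What is NOT here: the disc-to-strip polynomial `φ_ρ` (Barvinok 2016 Lemma 2.2.3); the
algorithmic statements (running times) are not formalised.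

## References
* [Barvinok2016] A. Barvinok, *Combinatorics and Complexity of Partition Functions*, Algorithms and
  Combinatorics 30, Springer 2016, §2.2: Lemma 2.2.1, §2.2.2 (paywalled; statement and proof taken
  from the author's own restatements below).
* [BarvinokDA2017] A. Barvinok, Approximating permanents and hafnians, *Discrete Analysis* 2017:2
  (arXiv:1601.07518), Lemma 7.1 with proof and §7.1 eq. (7.2.1). READ (pp. 14–16 of the arXiv
  version).
* [Barvinok2015] A. Barvinok, Computing the permanent of (some) complex matrices, *FoCM* 16 (2016),
  Lemma 1.2 and §2.2 (the original special case). READ.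
* [PatelRegts2017] V. Patel, G. Regts, *SIAM J. Comput.* 46 (2017), §2: Prop. 2.1 (Newton
  identities), Lemma 2.2. READ (arXiv:1607.01167 §2).
* A. Barvinok, On the zeros of partition functions with multi-spin interactions (arXiv:2406.04179,
  2024), Lemma 5.2: "This is Lemma 2.2.1 from [Ba16]" (statement with the open disc). READ.
-/

noncomputable section

open Polynomial Finset Filter
open scoped Topology

namespace Literature.Analysis.Complex

open _root_.Complex

/-! ### The objects: inverse power sums, Barvinok's branch of `log p`, its Taylor truncation -/

/-- The `k`-th **inverse power sum** `p_k = ∑_α α^{-k}` of the roots `α` of a complex polynomial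
(listed with multiplicity). For `k ≥ 1` these are `-k` times the Taylor coefficients of `ln p` at
`0` (`hasSum_rootLog`). [cite: PatelRegts2017, §2 (before Prop. 2.1)] -/
def invPowerSum (p : ℂ[X]) (k : ℕ) : ℂ :=
  (p.roots.map fun α => α⁻¹ ^ k).sum

/-- **Barvinok's branch of `ln p`** on a zero-free disc about `0`:
`f(z) = Log p(0) + ∑_α Log (1 - z/α)` (principal logarithms; sum over the roots with multiplicity).
It satisfies `exp (f z) = p z` off the roots (`exp_rootLog`) and is given by its Taylor series on
`‖z‖ < min_α ‖α‖` (`hasSum_rootLog`); when `p(0) > 0` it is the branch that is real at `0`.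
Junk value when `p(0) = 0`. [cite: BarvinokDA2017, proof of Lemma 7.1] -/
def rootLog (p : ℂ[X]) (z : ℂ) : ℂ :=
  log (p.eval 0) + (p.roots.map fun α => log (1 - z / α)).sum

/-- The **order-`m` Taylor polynomial** at `0` of Barvinok's branch of `ln p`:
`T_m(z) = Log p(0) - ∑_{k=1}^{m} (p_k/k) z^k` with `p_k = invPowerSum p k`
(written as a sum over `k + 1`, `k < m`). [cite: PatelRegts2017, §2 eq. (2.3)] -/
def logTaylorTrunc (p : ℂ[X]) (m : ℕ) (z : ℂ) : ℂ :=
  log (p.eval 0) - ∑ k ∈ range m, invPowerSum p (k + 1) / (k + 1) * z ^ (k + 1)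

/-- Unfolding lemma for `invPowerSum`. [folklore] -/
theorem invPowerSum_def (p : ℂ[X]) (k : ℕ) :
    invPowerSum p k = (p.roots.map fun α => α⁻¹ ^ k).sum := rfl

/-- Unfolding lemma for `rootLog`. [folklore] -/
theorem rootLog_def (p : ℂ[X]) (z : ℂ) :
    rootLog p z = log (p.eval 0) + (p.roots.map fun α => log (1 - z / α)).sum := rfl

/-- Unfolding lemma for `logTaylorTrunc`. [folklore] -/
theorem logTaylorTrunc_def (p : ℂ[X]) (m : ℕ) (z : ℂ) :
    logTaylorTrunc p m z
      = log (p.eval 0) - ∑ k ∈ range m, invPowerSum p (k + 1) / (k + 1) * z ^ (k + 1) := rfl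

/-- `T_0 = Log p(0)`. [folklore] -/
@[simp] theorem logTaylorTrunc_zero (p : ℂ[X]) (z : ℂ) : logTaylorTrunc p 0 z = log (p.eval 0) := by
  simp [logTaylorTrunc]

/-- At `z = 0` every truncation equals `Log p(0)`. [folklore] -/
@[simp] theorem logTaylorTrunc_at_zero (p : ℂ[X]) (m : ℕ) : logTaylorTrunc p m 0 = log (p.eval 0) := by
  simp [logTaylorTrunc]

/-- `rootLog p 0 = Log p(0)`. [folklore] -/
@[simp] theorem rootLog_zero (p : ℂ[X]) : rootLog p 0 = log (p.eval 0) := by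
  simp [rootLog]

/-- The summand of `T_m` written root by root:
`(p_{k+1}/(k+1)) z^{k+1} = ∑_α (z/α)^{k+1}/(k+1)`. [folklore] -/
theorem invPowerSum_div_mul_pow (p : ℂ[X]) (k : ℕ) (z : ℂ) :
    invPowerSum p (k + 1) / (k + 1) * z ^ (k + 1)
      = (p.roots.map fun α => (z / α) ^ (k + 1) / (k + 1)).sum := by
  have : (p.roots.map fun α => (z / α) ^ (k + 1) / (k + 1))
      = p.roots.map fun α => α⁻¹ ^ (k + 1) * (z ^ (k + 1) / (k + 1)) :=
    Multiset.map_congr rfl fun α _ => by rw [div_eq_mul_inv z, mul_pow]; ring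
  rw [this, Multiset.sum_map_mul_right, invPowerSum]
  ring

/-- Interchanging the sum over roots with a finite sum. [folklore] -/
theorem multiset_sum_map_finset_sum {ι κ : Type*} (s : Multiset ι) (t : Finset κ)
    (f : ι → κ → ℂ) :
    (s.map fun a => ∑ b ∈ t, f a b).sum = ∑ b ∈ t, (s.map fun a => f a b).sum := by
  induction s using Multiset.induction_on with
  | empty => simp
  | cons a s ih => simp [ih, Finset.sum_add_distrib]

/-- `rootLog - T_m`, root by root. [cite: BarvinokDA2017, proof of Lemma 7.1] -/
theorem rootLog_sub_logTaylorTrunc (p : ℂ[X]) (m : ℕ) (z : ℂ) :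
    rootLog p z - logTaylorTrunc p m z
      = (p.roots.map fun α => log (1 - z / α) + ∑ k ∈ range m, (z / α) ^ (k + 1) / (k + 1)).sum := by
  rw [Multiset.sum_map_add, multiset_sum_map_finset_sum, rootLog, logTaylorTrunc]
  simp_rw [invPowerSum_div_mul_pow]
  ring

/-! ### Factorisation over `ℂ` and the exponential of Barvinok's branch -/

/-- Roots of a polynomial with `p(0) ≠ 0` are nonzero. [folklore] -/
theorem ne_zero_of_mem_roots_of_eval_zero_ne {p : ℂ[X]} (h0 : p.eval 0 ≠ 0) {α : ℂ}
    (hα : α ∈ p.roots) : α ≠ 0 := by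
  rintro rfl
  exact h0 (mem_roots'.1 hα).2.eq_zero

/-- Over `ℂ`: `p(z) = p(0) ∏_α (1 - z/α)` when `p(0) ≠ 0`.
[cite: BarvinokDA2017, proof of Lemma 7.1] -/
theorem eval_eq_eval_zero_mul_prod (p : ℂ[X]) (h0 : p.eval 0 ≠ 0) (z : ℂ) :
    p.eval z = p.eval 0 * (p.roots.map fun α => 1 - z / α).prod := by
  have hp : C p.leadingCoeff * (p.roots.map fun a => X - C a).prod = p :=
    C_leadingCoeff_mul_prod_multiset_X_sub_C IsAlgClosed.card_roots_eq_natDegree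
  have hev : ∀ w : ℂ, p.eval w = p.leadingCoeff * (p.roots.map fun α => w - α).prod := by
    intro w
    conv_lhs => rw [← hp]
    simp [eval_multiset_prod, Multiset.map_map]
  have key : (p.roots.map fun α => z - α).prod
      = (p.roots.map fun α => (0 : ℂ) - α).prod * (p.roots.map fun α => 1 - z / α).prod := by
    rw [← Multiset.prod_map_mul]
    refine congr_arg _ (Multiset.map_congr rfl fun α hα => ?_)
    have hα0 := ne_zero_of_mem_roots_of_eval_zero_ne h0 hα
    field_simp
    ring
  rw [hev z, hev 0, key, mul_assoc]

/-- In the zero-free region each factor `1 - z/α` is nonzero. [folklore] -/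
theorem one_sub_div_ne_zero_of_eval_ne {p : ℂ[X]} (h0 : p.eval 0 ≠ 0) {z : ℂ}
    (hz : p.eval z ≠ 0) {α : ℂ} (hα : α ∈ p.roots) : 1 - z / α ≠ 0 := by
  intro h
  apply hz
  rw [eval_eq_eval_zero_mul_prod p h0 z]
  exact mul_eq_zero_of_right _ (Multiset.prod_eq_zero (Multiset.mem_map.2 ⟨α, hα, h⟩))

/-- **`rootLog` is a logarithm of `p`**: `exp (f z) = p(z)` wherever `p(z) ≠ 0` (given `p(0) ≠ 0`).
[cite: BarvinokDA2017, proof of Lemma 7.1] -/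
theorem exp_rootLog (p : ℂ[X]) (h0 : p.eval 0 ≠ 0) {z : ℂ} (hz : p.eval z ≠ 0) :
    exp (rootLog p z) = p.eval z := by
  rw [rootLog, exp_add, exp_log h0, exp_multiset_sum, Multiset.map_map,
    eval_eq_eval_zero_mul_prod p h0 z]
  congr 1
  exact congr_arg _ (Multiset.map_congr rfl fun α hα =>
    exp_log (one_sub_div_ne_zero_of_eval_ne h0 hz hα))

/-- Hence `re (f z) = log ‖p(z)‖`; in particular for `p(z) > 0` real, `re (f z) = log p(z)`.
[folklore] -/
theorem re_rootLog (p : ℂ[X]) (h0 : p.eval 0 ≠ 0) {z : ℂ} (hz : p.eval z ≠ 0) :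
    (rootLog p z).re = Real.log ‖p.eval z‖ := by
  rw [← exp_rootLog p h0 hz, norm_exp, Real.log_exp]

/-! ### The Taylor series of Barvinok's branch -/

/-- Shifted Taylor series of `-Log (1 - w)`: `∑_{k ≥ 0} w^{k+1}/(k+1) = -Log (1 - w)` for `‖w‖ < 1`.
[folklore] -/
theorem hasSum_pow_succ_div (w : ℂ) (hw : ‖w‖ < 1) :
    HasSum (fun k : ℕ => w ^ (k + 1) / (k + 1)) (-log (1 - w)) := by
  have h := (hasSum_nat_add_iff' (f := fun n : ℕ => w ^ n / n) 1).2 (hasSum_taylorSeries_neg_log hw)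
  simpa using h

/-- Finite sums of convergent series over a multiset. [folklore] -/
theorem hasSum_multiset_sum {ι : Type*} (s : Multiset ι) {f : ι → ℕ → ℂ} {a : ι → ℂ}
    (h : ∀ i ∈ s, HasSum (f i) (a i)) :
    HasSum (fun k => (s.map fun i => f i k).sum) (s.map a).sum := by
  induction s using Multiset.induction_on with
  | empty => simp
  | cons b s ih =>
    simp only [Multiset.map_cons, Multiset.sum_cons]
    exact (h b (Multiset.mem_cons_self b s)).add
      (ih fun i hi => h i (Multiset.mem_cons_of_mem hi))

/-- **`T_m` is the Taylor polynomial of Barvinok's branch**: on the disc `‖z‖ < min_α ‖α‖` (in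
particular on `‖z‖ < β` under the hypothesis of Lemma 2.2.1),
`f(z) = Log p(0) - ∑_{k ≥ 1} (p_k/k) z^k`. [cite: PatelRegts2017, §2 eq. (2.3)] -/
theorem hasSum_rootLog (p : ℂ[X]) {z : ℂ} (hz : ∀ α ∈ p.roots, ‖z‖ < ‖α‖) :
    HasSum (fun k : ℕ => -(invPowerSum p (k + 1) / (k + 1) * z ^ (k + 1)))
      (rootLog p z - log (p.eval 0)) := by
  have h : ∀ α ∈ p.roots,
      HasSum (fun k : ℕ => -((z / α) ^ (k + 1) / (k + 1))) (log (1 - z / α)) := by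
    intro α hα
    have hα0 : α ≠ 0 := by
      rintro rfl
      exact absurd (hz 0 hα) (by simp)
    have hw : ‖z / α‖ < 1 := by
      rw [norm_div, div_lt_one (norm_pos_iff.2 hα0)]
      exact hz α hα
    simpa using (hasSum_pow_succ_div (z / α) hw).neg
  have H := hasSum_multiset_sum p.roots h
  have e1 : (fun k : ℕ => (p.roots.map fun α => -((z / α) ^ (k + 1) / (k + 1))).sum)
      = fun k : ℕ => -(invPowerSum p (k + 1) / (k + 1) * z ^ (k + 1)) := by
    funext k
    rw [Multiset.sum_map_neg, invPowerSum_div_mul_pow]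
  have e2 : (p.roots.map fun α => log (1 - z / α)).sum = rootLog p z - log (p.eval 0) := by
    rw [rootLog]; ring
  rwa [e1, e2] at H

/-- The truncations `T_m(z)` converge to `f(z)` on the disc `‖z‖ < min_α ‖α‖`.
[cite: PatelRegts2017, §2] -/
theorem tendsto_logTaylorTrunc (p : ℂ[X]) {z : ℂ} (hz : ∀ α ∈ p.roots, ‖z‖ < ‖α‖) :
    Tendsto (fun m => logTaylorTrunc p m z) atTop (𝓝 (rootLog p z)) := by
  have h := ((hasSum_rootLog p hz).tendsto_sum_nat).const_add (log (p.eval 0))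
  rw [add_sub_cancel] at h
  refine h.congr fun m => ?_
  rw [logTaylorTrunc, Finset.sum_neg_distrib, sub_eq_add_neg]

/-! ### Lemma 2.2.1: the truncation error -/

/-- Roots of a polynomial without zeros in the open disc `‖z‖ < β` have norm `≥ β`. [folklore] -/
theorem le_norm_of_mem_roots {p : ℂ[X]} {β : ℝ} (hp : ∀ z : ℂ, ‖z‖ < β → p.eval z ≠ 0)
    {α : ℂ} (hα : α ∈ p.roots) : β ≤ ‖α‖ :=
  not_lt.1 fun h => hp α h (mem_roots'.1 hα).2.eq_zero

/-- `(-1)^{n+1} (-w)^n = -w^n`. [folklore] -/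
theorem neg_one_pow_succ_mul_neg_pow (w : ℂ) (n : ℕ) : (-1 : ℂ) ^ (n + 1) * (-w) ^ n = -w ^ n := by
  rw [pow_succ', mul_assoc, ← mul_pow]
  simp

/-- Mathlib's `logTaylor (m+1)` at `-w` is `-∑_{k<m} w^{k+1}/(k+1)`. [folklore] -/
theorem logTaylor_succ_neg (m : ℕ) (w : ℂ) :
    logTaylor (m + 1) (-w) = -∑ k ∈ range m, w ^ (k + 1) / (k + 1) := by
  rw [logTaylor, Finset.sum_range_succ', ← Finset.sum_neg_distrib]
  simp only [pow_zero, Nat.cast_zero, div_zero, add_zero]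
  refine Finset.sum_congr rfl fun k _ => ?_
  rw [neg_one_pow_succ_mul_neg_pow, neg_div]
  push_cast
  ring

/-- **The tail of the logarithmic series** (the estimate `|ξ_j| ≤ 1/((m+1)β^m(β-1))` in Barvinok's
proof, before specialising `q = 1/β`): for `‖w‖ ≤ q < 1`,
`|Log(1 - w) + ∑_{k=1}^{m} w^k/k| ≤ q^{m+1}/((m+1)(1-q))`.
[cite: BarvinokDA2017, proof of Lemma 7.1] -/
theorem norm_log_one_sub_add_sum_le {w : ℂ} {q : ℝ} (hw : ‖w‖ ≤ q) (hq : q < 1) (m : ℕ) :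
    ‖log (1 - w) + ∑ k ∈ range m, w ^ (k + 1) / (k + 1)‖ ≤ q ^ (m + 1) / ((m + 1) * (1 - q)) := by
  have hq0 : 0 ≤ q := (norm_nonneg w).trans hw
  have h1 : ‖-w‖ < 1 := by rw [norm_neg]; exact hw.trans_lt hq
  have hA : ‖w‖ ^ (m + 1) ≤ q ^ (m + 1) := pow_le_pow_left₀ (norm_nonneg _) hw _
  have hB : (1 - ‖w‖)⁻¹ ≤ (1 - q)⁻¹ := inv_anti₀ (by linarith) (by linarith)
  calc ‖log (1 - w) + ∑ k ∈ range m, w ^ (k + 1) / (k + 1)‖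
      = ‖log (1 + -w) - logTaylor (m + 1) (-w)‖ := by
        rw [logTaylor_succ_neg, sub_neg_eq_add, ← sub_eq_add_neg]
    _ ≤ ‖-w‖ ^ (m + 1) * (1 - ‖-w‖)⁻¹ / (m + 1) := norm_log_sub_logTaylor_le m h1
    _ ≤ q ^ (m + 1) * (1 - q)⁻¹ / (m + 1) := by
        rw [norm_neg]
        exact div_le_div_of_nonneg_right
          (mul_le_mul hA hB (inv_nonneg.2 (by linarith)) (pow_nonneg hq0 _)) (by positivity)
    _ = q ^ (m + 1) / ((m + 1) * (1 - q)) := by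
        rw [← div_eq_mul_inv, div_right_comm, ← div_mul_eq_div_div]

/-- Norm of a multiset sum with uniformly bounded terms. [folklore] -/
theorem norm_multiset_sum_map_le_card_mul {ι : Type*} (s : Multiset ι) (f : ι → ℂ) {B : ℝ}
    (h : ∀ i ∈ s, ‖f i‖ ≤ B) : ‖(s.map f).sum‖ ≤ Multiset.card s * B := by
  induction s using Multiset.induction_on with
  | empty => simp
  | cons a s ih =>
    simp only [Multiset.map_cons, Multiset.sum_cons, Multiset.card_cons, Nat.cast_add, Nat.cast_one]
    calc ‖f a + (s.map f).sum‖ ≤ ‖f a‖ + ‖(s.map f).sum‖ := norm_add_le _ _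
      _ ≤ B + Multiset.card s * B :=
          add_le_add (h a (Multiset.mem_cons_self a s))
            (ih fun i hi => h i (Multiset.mem_cons_of_mem hi))
      _ = (Multiset.card s + 1) * B := by ring

/-- **Barvinok's Taylor-truncation lemma** (Barvinok 2016, Lemma 2.2.1; Barvinok DA 2017,
Lemma 7.1; in the form of Barvinok 2024, Lemma 5.2). Let `p` be a complex polynomial of degree `N`
with `p(z) ≠ 0` for all `‖z‖ < β`, where `β > 1`, and let `f = rootLog p` be the branch of `ln p`
with `f(0) = Log p(0)`. Then for every `m` and every `‖z‖ ≤ 1`,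
`|f(z) - T_m(z)| ≤ N / ((m+1) β^m (β-1))`, where `T_m = logTaylorTrunc p m` is the order-`m` Taylor
polynomial of `f` at `0`. [cite: Barvinok2016, Lemma 2.2.1] -/
theorem norm_rootLog_sub_logTaylorTrunc_le (p : ℂ[X]) {β : ℝ} (hβ : 1 < β)
    (hp : ∀ z : ℂ, ‖z‖ < β → p.eval z ≠ 0) (m : ℕ) {z : ℂ} (hz : ‖z‖ ≤ 1) :
    ‖rootLog p z - logTaylorTrunc p m z‖ ≤ p.natDegree / ((m + 1) * β ^ m * (β - 1)) := by
  have hβ0 : 0 < β := one_pos.trans hβ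
  have hq : β⁻¹ < 1 := inv_lt_one_of_one_lt₀ hβ
  -- per-root estimate
  have hroot : ∀ α ∈ p.roots,
      ‖log (1 - z / α) + ∑ k ∈ range m, (z / α) ^ (k + 1) / (k + 1)‖
        ≤ β⁻¹ ^ (m + 1) / ((m + 1) * (1 - β⁻¹)) := by
    intro α hα
    have hαβ : β ≤ ‖α‖ := le_norm_of_mem_roots hp hα
    have hα0 : 0 < ‖α‖ := hβ0.trans_le hαβ
    refine norm_log_one_sub_add_sum_le ?_ hq m
    rw [norm_div, div_le_iff₀ hα0]
    calc ‖z‖ ≤ 1 := hz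
      _ = β⁻¹ * β := by rw [inv_mul_cancel₀ hβ0.ne']
      _ ≤ β⁻¹ * ‖α‖ := mul_le_mul_of_nonneg_left hαβ (inv_nonneg.2 hβ0.le)
  rw [rootLog_sub_logTaylorTrunc]
  refine (norm_multiset_sum_map_le_card_mul _ _ hroot).trans ?_
  have hcard : (Multiset.card p.roots : ℝ) ≤ p.natDegree := by exact_mod_cast p.card_roots'
  have hden : 0 < (m + 1) * β ^ m * (β - 1) := by
    have : 0 < β - 1 := sub_pos.2 hβ
    positivity
  have hfac : β⁻¹ ^ (m + 1) / ((m + 1) * (1 - β⁻¹)) = 1 / ((m + 1) * β ^ m * (β - 1)) := by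
    have h1 : (1 : ℝ) - β⁻¹ ≠ 0 := (sub_pos.2 hq).ne'
    rw [div_eq_div_iff (mul_ne_zero (by positivity) h1) hden.ne', one_mul, pow_succ]
    have h2 : β⁻¹ ^ m * β ^ m = 1 := by rw [← mul_pow, inv_mul_cancel₀ hβ0.ne', one_pow]
    have h3 : β⁻¹ * (β - 1) = 1 - β⁻¹ := by rw [mul_sub, inv_mul_cancel₀ hβ0.ne', mul_one]
    calc β⁻¹ ^ m * β⁻¹ * ((m + 1) * β ^ m * (β - 1))
        = (β⁻¹ ^ m * β ^ m) * (β⁻¹ * (β - 1)) * (m + 1) := by ring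
      _ = (m + 1) * (1 - β⁻¹) := by rw [h2, h3]; ring
  rw [hfac]
  calc (Multiset.card p.roots : ℝ) * (1 / ((m + 1) * β ^ m * (β - 1)))
      ≤ p.natDegree * (1 / ((m + 1) * β ^ m * (β - 1))) :=
        mul_le_mul_of_nonneg_right hcard (by positivity)
    _ = p.natDegree / ((m + 1) * β ^ m * (β - 1)) := by ring

/-- Lemma 2.2.1 exactly as printed in the book / DA paper: closed disc `‖z‖ ≤ β` in the hypothesis,
conclusion at `z = 1`. [cite: BarvinokDA2017, Lemma 7.1] -/
theorem norm_rootLog_one_sub_logTaylorTrunc_one_le (p : ℂ[X]) {β : ℝ} (hβ : 1 < β)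
    (hp : ∀ z : ℂ, ‖z‖ ≤ β → p.eval z ≠ 0) (m : ℕ) :
    ‖rootLog p 1 - logTaylorTrunc p m 1‖ ≤ p.natDegree / ((m + 1) * β ^ m * (β - 1)) :=
  norm_rootLog_sub_logTaylorTrunc_le p hβ (fun z hz => hp z hz.le) m (by simp)

/-! ### §2.2.2: the Taylor coefficients are determined by `a₀, …, a_m` (Newton identities) -/

section Newton

variable {R : Type*} [CommRing R]

/-- Coefficients of `(1 - γ X) q`: degree `0`. [folklore] -/
theorem coeff_one_sub_C_mul_X_mul_zero (γ : R) (q : R[X]) :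
    ((1 - C γ * X) * q).coeff 0 = q.coeff 0 := by
  simp [sub_mul, mul_assoc]

/-- Coefficients of `(1 - γ X) q`: degree `i + 1`. [folklore] -/
theorem coeff_one_sub_C_mul_X_mul_succ (γ : R) (q : R[X]) (i : ℕ) :
    ((1 - C γ * X) * q).coeff (i + 1) = q.coeff (i + 1) - γ * q.coeff i := by
  simp [sub_mul, mul_assoc, coeff_C_mul, coeff_X_mul]

/-- Coefficients of `(1 - γ X) q`: degree `1`. [folklore] -/
theorem coeff_one_sub_C_mul_X_mul_one (γ : R) (q : R[X]) :
    ((1 - C γ * X) * q).coeff 1 = q.coeff 1 - γ * q.coeff 0 :=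
  coeff_one_sub_C_mul_X_mul_succ γ q 0

/-- **Newton's identities for `∏_γ (1 - γ X)`** over a commutative ring, in the inverse-power-sum
form of Patel–Regts Prop. 2.1: writing `e_i` for the coefficients of `Q = ∏_{γ ∈ s} (1 - γ X)` and
`P_j = ∑_{γ ∈ s} γ^j`, for every `n`,
`(n+1) e_{n+1} = -∑_{i+j=n} e_i P_{j+1}`. Proved by induction on the multiset `s`.
[cite: PatelRegts2017, Prop. 2.1] -/
theorem newton_prod_one_sub_C_mul_X (s : Multiset R) (n : ℕ) :
    ((n : R) + 1) * ((s.map fun γ => 1 - C γ * X).prod).coeff (n + 1)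
      = -∑ ij ∈ antidiagonal n,
          ((s.map fun γ => 1 - C γ * X).prod).coeff ij.1 * (s.map fun γ => γ ^ (ij.2 + 1)).sum := by
  induction s using Multiset.induction_on generalizing n with
  | empty =>
    simp [coeff_one]
  | cons γ t ih =>
    -- `q` the product over `t`; its coefficients are the `e_i`, the power sums over `t` the `P_j`
    set q : R[X] := (t.map fun γ => 1 - C γ * X).prod with hq
    have hprod : ((γ ::ₘ t).map fun γ => 1 - C γ * X).prod = (1 - C γ * X) * q := by
      simp [hq]
    have hps : ∀ j : ℕ, ((γ ::ₘ t).map fun δ => δ ^ (j + 1)).sum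
        = γ ^ (j + 1) + (t.map fun δ => δ ^ (j + 1)).sum := fun j => by simp
    simp only [hprod, hps]
    -- the two expansions of `∑_{i+j=k+1} e_i γ^{j+1}`
    have hU : ∀ k : ℕ, q.coeff 0 * γ ^ (k + 1 + 1)
        + ∑ ij ∈ antidiagonal k, q.coeff (ij.1 + 1) * γ ^ (ij.2 + 1)
        = q.coeff (k + 1) * γ + γ * ∑ ij ∈ antidiagonal k, q.coeff ij.1 * γ ^ (ij.2 + 1) := by
      intro k
      have h1 : ∑ ij ∈ antidiagonal (k + 1), q.coeff ij.1 * γ ^ (ij.2 + 1)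
          = q.coeff 0 * γ ^ (k + 1 + 1)
            + ∑ ij ∈ antidiagonal k, q.coeff (ij.1 + 1) * γ ^ (ij.2 + 1) :=
        Finset.Nat.sum_antidiagonal_succ
      have h2 : ∑ ij ∈ antidiagonal (k + 1), q.coeff ij.1 * γ ^ (ij.2 + 1)
          = q.coeff (k + 1) * γ ^ (0 + 1)
            + ∑ ij ∈ antidiagonal k, q.coeff ij.1 * γ ^ (ij.2 + 1 + 1) :=
        Finset.Nat.sum_antidiagonal_succ'
      rw [← h1, h2, Finset.mul_sum]
      congr 1
      · ring
      · exact Finset.sum_congr rfl fun ij _ => by ring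
    cases n with
    | zero =>
      have ih0 := ih 0
      simp only [Finset.Nat.antidiagonal_zero, Finset.sum_singleton, zero_add, Nat.cast_zero,
        one_mul, pow_one, coeff_one_sub_C_mul_X_mul_one, coeff_one_sub_C_mul_X_mul_zero] at ih0 ⊢
      linear_combination ih0
    | succ n =>
      have ihn := ih n
      have ihn1 := ih (n + 1)
      have hUn := hU n
      rw [Finset.Nat.sum_antidiagonal_succ]
      simp only [coeff_one_sub_C_mul_X_mul_succ, coeff_one_sub_C_mul_X_mul_zero]
      rw [Finset.Nat.sum_antidiagonal_succ] at ihn1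
      simp only at ihn1
      -- expand the sum over `antidiagonal n` into its four pieces
      have hsplit : ∑ ij ∈ antidiagonal n,
          (q.coeff (ij.1 + 1) - γ * q.coeff ij.1)
            * (γ ^ (ij.2 + 1) + (t.map fun δ => δ ^ (ij.2 + 1)).sum)
          = ∑ ij ∈ antidiagonal n, q.coeff (ij.1 + 1) * γ ^ (ij.2 + 1)
            + ∑ ij ∈ antidiagonal n, q.coeff (ij.1 + 1) * (t.map fun δ => δ ^ (ij.2 + 1)).sum
            - γ * ∑ ij ∈ antidiagonal n, q.coeff ij.1 * γ ^ (ij.2 + 1)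
            - γ * ∑ ij ∈ antidiagonal n, q.coeff ij.1 * (t.map fun δ => δ ^ (ij.2 + 1)).sum := by
        rw [Finset.mul_sum, Finset.mul_sum, ← Finset.sum_add_distrib, ← Finset.sum_sub_distrib,
          ← Finset.sum_sub_distrib]
        refine Finset.sum_congr rfl fun ij _ => ?_
        ring
      rw [hsplit]
      push_cast at ihn ihn1 ⊢
      linear_combination ihn1 + hUn - γ * ihn

end Newton

/-- Over `ℂ`: `p = a₀ ∏_α (1 - α⁻¹ X)` when `a₀ = p(0) ≠ 0`. [folklore] -/
theorem eq_C_mul_prod_one_sub_inv_mul_X (p : ℂ[X]) (h0 : p.coeff 0 ≠ 0) :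
    p = C (p.coeff 0) * (p.roots.map fun α => 1 - C α⁻¹ * X).prod := by
  have h0' : p.eval 0 ≠ 0 := by rwa [← coeff_zero_eq_eval_zero]
  have hp : C p.leadingCoeff * (p.roots.map fun a => X - C a).prod = p :=
    C_leadingCoeff_mul_prod_multiset_X_sub_C IsAlgClosed.card_roots_eq_natDegree
  have hfac : (p.roots.map fun a => X - C a).prod
      = C (p.roots.map fun a => -a).prod * (p.roots.map fun α => 1 - C α⁻¹ * X).prod := by
    rw [map_multiset_prod C, Multiset.map_map, ← Multiset.prod_map_mul]
    refine congr_arg _ (Multiset.map_congr rfl fun α hα => ?_)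
    have hα0 := ne_zero_of_mem_roots_of_eval_zero_ne h0' hα
    have hX : C α * (C α⁻¹ * X) = X := by
      rw [← mul_assoc, ← C_mul, mul_inv_cancel₀ hα0, C_1, one_mul]
    simp only [Function.comp_apply, map_neg]
    linear_combination -hX
  have key : p = C (p.leadingCoeff * (p.roots.map fun a => -a).prod)
      * (p.roots.map fun α => 1 - C α⁻¹ * X).prod := by
    conv_lhs => rw [← hp, hfac]
    rw [C_mul, mul_assoc]
  have hc0 : ((p.roots.map fun α => 1 - C α⁻¹ * X).prod).coeff 0 = 1 := by
    rw [coeff_zero_multiset_prod, Multiset.map_map]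
    simp
  have hconst : p.coeff 0 = p.leadingCoeff * (p.roots.map fun a => -a).prod := by
    conv_lhs => rw [key]
    rw [coeff_C_mul, hc0, mul_one]
  rw [hconst]
  exact key

/-- **§2.2.2 / Newton identities for the inverse power sums** (Patel–Regts 2017, Prop. 2.1; the
coefficient form of Barvinok's triangular system (2.2.2)): if `p = ∑ a_i X^i ∈ ℂ[X]` has
`a₀ ≠ 0`, then for every `k`, `k a_k = -∑_{i<k} a_i p_{k-i}`, `p_j = invPowerSum p j`.
[cite: PatelRegts2017, Prop. 2.1] -/
theorem natCast_mul_coeff_eq_neg_sum (p : ℂ[X]) (h0 : p.coeff 0 ≠ 0) (k : ℕ) :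
    (k : ℂ) * p.coeff k = -∑ i ∈ range k, p.coeff i * invPowerSum p (k - i) := by
  cases k with
  | zero => simp
  | succ n =>
    set s : Multiset ℂ := p.roots.map fun α => α⁻¹ with hs
    set Q : ℂ[X] := (s.map fun γ => 1 - C γ * X).prod with hQ
    have hpQ : p = C (p.coeff 0) * Q := by
      rw [hQ, hs, Multiset.map_map]
      exact eq_C_mul_prod_one_sub_inv_mul_X p h0
    have hcoeff : ∀ i, p.coeff i = p.coeff 0 * Q.coeff i := fun i => by
      conv_lhs => rw [hpQ]
      rw [coeff_C_mul]
    have hpow : ∀ j, invPowerSum p j = (s.map fun γ => γ ^ j).sum := fun j => by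
      rw [invPowerSum, hs, Multiset.map_map]
      rfl
    have hN := newton_prod_one_sub_C_mul_X s n
    rw [← hQ, Finset.Nat.sum_antidiagonal_eq_sum_range_succ_mk] at hN
    simp only [Nat.succ_eq_add_one] at hN
    have hsum : ∑ i ∈ range (n + 1), p.coeff i * invPowerSum p (n + 1 - i)
        = ∑ i ∈ range (n + 1), p.coeff 0 * (Q.coeff i * (s.map fun γ => γ ^ (n - i + 1)).sum) := by
      refine Finset.sum_congr rfl fun i hi => ?_
      have hi' : i < n + 1 := Finset.mem_range.1 hi
      rw [hcoeff i, hpow, show n + 1 - i = n - i + 1 by omega, mul_assoc]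
    rw [hsum, ← Finset.mul_sum, hcoeff (n + 1)]
    push_cast
    linear_combination (p.coeff 0) * hN

/-- The triangular system solved: `a₀, …, a_m` determine `p_1, …, p_m`. If two complex polynomials
with nonzero constant term have the same coefficients in degrees `≤ m`, they have the same inverse
power sums `p_k`, `1 ≤ k ≤ m` (but in general not `p_0 = deg`). [cite: Barvinok2016, §2.2.2] -/
theorem invPowerSum_eq_of_coeff_eq {p q : ℂ[X]} (hp : p.coeff 0 ≠ 0) {m : ℕ}
    (h : ∀ i ≤ m, p.coeff i = q.coeff i) {k : ℕ} (hk1 : 1 ≤ k) (hkm : k ≤ m) :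
    invPowerSum p k = invPowerSum q k := by
  have hq : q.coeff 0 ≠ 0 := by rwa [← h 0 (Nat.zero_le _)]
  induction k using Nat.strong_induction_on with
  | _ k ih =>
    obtain ⟨n, rfl⟩ : ∃ n, k = n + 1 := ⟨k - 1, by omega⟩
    have hP := natCast_mul_coeff_eq_neg_sum p hp (n + 1)
    have hQ := natCast_mul_coeff_eq_neg_sum q hq (n + 1)
    rw [Finset.sum_range_succ'] at hP hQ
    simp only [Nat.sub_zero, Nat.add_sub_add_right] at hP hQ
    have hS : ∑ i ∈ range n, p.coeff (i + 1) * invPowerSum p (n - i)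
        = ∑ i ∈ range n, q.coeff (i + 1) * invPowerSum q (n - i) := by
      refine Finset.sum_congr rfl fun i hi => ?_
      have hi' : i < n := Finset.mem_range.1 hi
      rw [h (i + 1) (by omega), ih (n - i) (by omega) (by omega) (by omega)]
    have h0 : p.coeff 0 = q.coeff 0 := h 0 (Nat.zero_le _)
    have hn1 : p.coeff (n + 1) = q.coeff (n + 1) := h (n + 1) hkm
    have key : p.coeff 0 * invPowerSum p (n + 1) = p.coeff 0 * invPowerSum q (n + 1) := by
      rw [hS, hn1, h0] at hP
      rw [h0]
      linear_combination hP - hQ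
    exact mul_left_cancel₀ hp key

/-- Equal coefficients up to degree `m` (and `a₀ ≠ 0`) give equal Taylor truncations `T_m`.
[cite: Barvinok2016, §2.2.2] -/
theorem logTaylorTrunc_eq_of_coeff_eq {p q : ℂ[X]} (hp : p.coeff 0 ≠ 0) {m : ℕ}
    (h : ∀ i ≤ m, p.coeff i = q.coeff i) (z : ℂ) :
    logTaylorTrunc p m z = logTaylorTrunc q m z := by
  have h0 : p.eval 0 = q.eval 0 := by
    rw [← coeff_zero_eq_eval_zero, ← coeff_zero_eq_eval_zero, h 0 (Nat.zero_le _)]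
  rw [logTaylorTrunc, logTaylorTrunc, h0]
  congr 1
  refine Finset.sum_congr rfl fun k hk => ?_
  have hk' : k < m := Finset.mem_range.1 hk
  rw [invPowerSum_eq_of_coeff_eq hp h (Nat.succ_pos k) (by omega)]

/-- **Two zero-free polynomials with the same low coefficients have close logarithms**: if `p, q`
have no zeros in `‖z‖ < β` (`β > 1`) and the same coefficients in degrees `≤ m`, then
`|f_p(z) - f_q(z)| ≤ (deg p + deg q)/((m+1) β^m (β-1))` for `‖z‖ ≤ 1` (Lemma 2.2.1 twice, the
truncations being equal by §2.2.2). [cite: Barvinok2016, Lemma 2.2.1 and §2.2.2] -/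
theorem norm_rootLog_sub_rootLog_le {p q : ℂ[X]} {β : ℝ} (hβ : 1 < β)
    (hp : ∀ z : ℂ, ‖z‖ < β → p.eval z ≠ 0) (hq : ∀ z : ℂ, ‖z‖ < β → q.eval z ≠ 0)
    {m : ℕ} (h : ∀ i ≤ m, p.coeff i = q.coeff i) {z : ℂ} (hz : ‖z‖ ≤ 1) :
    ‖rootLog p z - rootLog q z‖ ≤ (p.natDegree + q.natDegree) / ((m + 1) * β ^ m * (β - 1)) := by
  have hp0 : p.coeff 0 ≠ 0 := by
    rw [coeff_zero_eq_eval_zero]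
    exact hp 0 (by rw [norm_zero]; exact one_pos.trans hβ)
  have hT := logTaylorTrunc_eq_of_coeff_eq hp0 h z
  have h1 := norm_rootLog_sub_logTaylorTrunc_le p hβ hp m hz
  have h2 := norm_rootLog_sub_logTaylorTrunc_le q hβ hq m hz
  rw [hT] at h1
  calc ‖rootLog p z - rootLog q z‖
      = ‖(rootLog p z - logTaylorTrunc q m z) - (rootLog q z - logTaylorTrunc q m z)‖ := by
        congr 1; ring
    _ ≤ ‖rootLog p z - logTaylorTrunc q m z‖ + ‖rootLog q z - logTaylorTrunc q m z‖ :=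
        norm_sub_le _ _
    _ ≤ p.natDegree / ((m + 1) * β ^ m * (β - 1)) + q.natDegree / ((m + 1) * β ^ m * (β - 1)) :=
        add_le_add h1 h2
    _ = (p.natDegree + q.natDegree) / ((m + 1) * β ^ m * (β - 1)) := by ring

/-- The same for the real logarithms of the absolute values (for positive real values `p(z), q(z)`:
of the values themselves): `|log ‖p(z)‖ - log ‖q(z)‖| ≤ (deg p + deg q)/((m+1) β^m (β-1))`.
This is the form used for partition functions at a real activity.
[cite: Barvinok2016, Lemma 2.2.1 and §2.2.2] -/
theorem abs_log_norm_eval_sub_log_norm_eval_le {p q : ℂ[X]} {β : ℝ} (hβ : 1 < β)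
    (hp : ∀ z : ℂ, ‖z‖ < β → p.eval z ≠ 0) (hq : ∀ z : ℂ, ‖z‖ < β → q.eval z ≠ 0)
    {m : ℕ} (h : ∀ i ≤ m, p.coeff i = q.coeff i) {z : ℂ} (hz : ‖z‖ ≤ 1) :
    |Real.log ‖p.eval z‖ - Real.log ‖q.eval z‖|
      ≤ (p.natDegree + q.natDegree) / ((m + 1) * β ^ m * (β - 1)) := by
  have hzβ : ‖z‖ < β := hz.trans_lt hβ
  have hβ0 : ‖(0 : ℂ)‖ < β := by rw [norm_zero]; exact one_pos.trans hβ
  rw [← re_rootLog p (hp 0 hβ0) (hp z hzβ), ← re_rootLog q (hq 0 hβ0) (hq z hzβ), ← sub_re]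
  exact (abs_re_le_norm _).trans (norm_rootLog_sub_rootLog_le hβ hp hq h hz)

end Literature.Analysis.Complex
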